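import Literature.AlgebraicGeometry.Resolution.BlowupSequences
import Literature.AlgebraicGeometry.Resolution.BlowupsExistence
import Literature.AlgebraicGeometry.Resolution.BlowupsIntegral
import Literature.AlgebraicGeometry.Resolution.BlowupsProperProofs
import Literature.AlgebraicGeometry.Limits.IdealSheafExtension
import Mathlib.AlgebraicGeometry.Noetherian
import HarnessLib

/-!
# Crux `PatchingRel` (stmt-ResolutionOfSingularities-0642), line `sandwiched-gluing` (v3 cut),
# stub `stub_exists_isPullback_of_isBlowup`

**Extending a blowing up from an open subscheme of an integral locally Noetherian scheme.** Let
`M` be an integral locally Noetherian scheme, `O ⊆ M` an open and `π : N₀ → O` a blowing up of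
`O` along a non-zero (quasi-coherent) ideal sheaf `I` (`IsBlowup π I`). Let `C := I.map O.ι` be
the push-forward of `I` along the open immersion `O ↪ M` (the largest ideal sheaf of `M`
restricting to `I`; its closed subscheme is the scheme-theoretic closure in `M` of the centre
`V(I) ⊆ O`), and `ρ : Z := Bl_C(M) → M` the blowing up of `M` along `C`. Then

* `C|_O = I` (`Literature.AlgebraicGeometry.Limits.comap_map_of_isOpenImmersion`; the open
  immersion `O ↪ M` is quasi-compact because `M` is locally Noetherian), so `C ≠ 0`;
* hence `Z` is integral and `ρ` is proper and birational (blowing ups of integral schemes along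
  non-zero ideals, `IsBlowup.isIntegral`, `IsBlowup.isBirational'`; blowing ups of locally
  Noetherian schemes are proper, `IsBlowup.isProper`);
* blowing up commutes with open immersions (Görtz–Wedhorn I, Prop. 13.91 (2),
  `IsBlowup.isPullback_of_isOpenImmersion`): the morphism `s : N₀ → Z` over `O ↪ M` given by the
  universal property of `Z` is an open immersion and `N₀ = Z ×_M O` (`IsPullback s π ρ O.ι`).

This is the device of Piltant 2013, proof of Prop. 5.1, Step 2 ("blow up the Zariski closure of
the centre"), for a general centre: `exists_isPullback_of_isBlowup_opens` (universe polymorphic)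
and the registered universe-`0` stub `stub_exists_isPullback_of_isBlowup`, consumed by the bridge
`SANDᵇ ⇒ SANDᴸ` of the line (a blowing-up resolution of the sandwiched-singularity open `O ⊆ M`
extends to a proper birational modification of `M`, regular over `O`).

## References

* O. Piltant, *An axiomatic version of Zariski's patching theorem*, RACSAM 107 (2013) 91–121,
  Prop. 5.1 (proof, Step 2). [Piltant2013]
* U. Görtz, T. Wedhorn, *Algebraic Geometry I*, 2nd ed. (2020), Prop. 13.91 (blowing up
  commutes with flat base change), Prop. 13.96 (1) (blowing ups are projective).
  [GortzWedhorn2020]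
-/

-- `Summit.<Summit>.<Sub>.Theorems` with `Sub = Summit` (single-conjunct summit, D-0017): the
-- duplicated namespace component is the tree layout.
set_option linter.dupNamespace false

noncomputable section

namespace Summit.ResolutionOfSingularities.ResolutionOfSingularities.Theorems

open CategoryTheory AlgebraicGeometry
open Literature.AlgebraicGeometry.Resolution

universe u

/-- **Extension of a blowing up from an open subscheme** (Piltant 2013, proof of Prop. 5.1,
Step 2, for a general centre). For an integral locally Noetherian scheme `M`, an open `O ⊆ M`
and a blowing up `π : N₀ → O` of `O` along a non-zero ideal sheaf `I`, the blowing up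
`ρ : Z → M` of `M` along the push-forward ideal `I.map O.ι` has integral source, is proper and
birational, and restricts over `O` to `π`: there is an open immersion `s : N₀ → Z` with
`N₀ = Z ×_M O` (`IsPullback s π ρ O.ι`). Proof: `(I.map O.ι)|_O = I`
(`comap_map_of_isOpenImmersion`, `O ↪ M` being quasi-compact as `M` is locally Noetherian), so
the push-forward is non-zero, and blowing up commutes with open immersions
(`IsBlowup.isPullback_of_isOpenImmersion`, Görtz–Wedhorn I, Prop. 13.91 (2)).
[cite: Piltant2013, Prop. 5.1 (proof, Step 2)] -/
theorem exists_isPullback_of_isBlowup_opens {M : Scheme.{u}} [IsIntegral M]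
    [IsLocallyNoetherian M] (O : M.Opens) {N₀ : Scheme.{u}} {π : N₀ ⟶ (O : Scheme.{u})}
    {I : (O : Scheme.{u}).IdealSheafData} (hI : I ≠ ⊥) (hπ : IsBlowup π I) :
    ∃ (Z : Scheme.{u}) (ρ : Z ⟶ M) (s : N₀ ⟶ Z), IsIntegral Z ∧ IsProper ρ ∧ IsBirational ρ ∧
      IsOpenImmersion s ∧ IsPullback s π ρ O.ι ∧ IsBlowup ρ (I.map O.ι) := by
  -- the push-forward ideal and its restriction to `O`
  let C : M.IdealSheafData := I.map O.ι
  have hC : C.comap O.ι = I :=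
    Literature.AlgebraicGeometry.Limits.comap_map_of_isOpenImmersion O.ι I
  have hC0 : C ≠ ⊥ := by
    intro h
    apply hI
    rw [← hC, h, Scheme.IdealSheafData.comap_bot]
  have hπ' : IsBlowup π (C.comap O.ι) := by rw [hC]; exact hπ
  -- the comparison morphism `N₀ → Bl_C(M)` over `O ↪ M`
  let s : N₀ ⟶ blowup C := (blowup.isBlowup C).lift (π ≫ O.ι)
    (by rw [Scheme.IdealSheafData.comap_comp]; exact hπ'.isEffectiveCartier)
  have hsπ : s ≫ blowup.π C = π ≫ O.ι := (blowup.isBlowup C).lift_comp _ _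
  have hsq : IsPullback s π (blowup.π C) O.ι :=
    (blowup.isBlowup C).isPullback_of_isOpenImmersion O.ι hπ' hsπ
  haveI : IsOpenImmersion s := MorphismProperty.of_isPullback hsq.flip inferInstance
  exact ⟨blowup C, blowup.π C, s, (blowup.isBlowup C).isIntegral hC0, (blowup.isBlowup C).isProper,
    (blowup.isBlowup C).isBirational' hC0, inferInstance, hsq, blowup.isBlowup C⟩

/-- **Stub `stub_exists_isPullback_of_isBlowup` of line `sandwiched-gluing`** (crux
`PatchingRel`, stmt-ResolutionOfSingularities-0642), the universe-`0` instance of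
`exists_isPullback_of_isBlowup_opens`: a blowing up `π : N₀ → O` of an open `O` of an integral
locally Noetherian scheme `M` along a non-zero ideal sheaf `I` extends to the blowing up
`ρ : Z → M` of `M` along `I.map O.ι`, which is proper and birational with integral source and
satisfies `N₀ = Z ×_M O` along an open immersion `s : N₀ → Z`.
[cite: Piltant2013, Prop. 5.1 (proof, Step 2)] -/
theorem stub_exists_isPullback_of_isBlowup :
    ∀ (M : Scheme.{0}) [IsIntegral M] [IsLocallyNoetherian M] (O : M.Opens) (N₀ : Scheme.{0})
      (π : N₀ ⟶ (O : Scheme.{0})) (I : (O : Scheme.{0}).IdealSheafData), I ≠ ⊥ → IsBlowup π I →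
      ∃ (Z : Scheme.{0}) (ρ : Z ⟶ M) (s : N₀ ⟶ Z), IsIntegral Z ∧ IsProper ρ ∧ IsBirational ρ ∧
        IsOpenImmersion s ∧ IsPullback s π ρ O.ι ∧ IsBlowup ρ (I.map O.ι) :=
  fun _ _ _ O _ _ _ hI hπ => exists_isPullback_of_isBlowup_opens O hI hπ

end Summit.ResolutionOfSingularities.ResolutionOfSingularities.Theorems

end
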